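import Summits.HubbardSuperconductivity.HubbardSuperconductivity.Theorems.NodalWardXYPerturbedXYOrderLaplace

/-!
# `PerturbedXYOrder` (stmt-HubbardSuperconductivity-10739) — line `schwarz-inheritance`: complex stability at fixed volume

For every radius `ε` and every torus `(ℤ/Lℤ)³` there is a coupling `J₀ = J₀(ε, L)` beyond which every kernel
admissible at radius `ε` has `Z_K ≠ 0` and `‖cratio‖ ≤ 2` (`stub_fixedVolumeStability`).  Mechanism
(`fv_master`): the relative form bound `‖W_K(θ)‖ ≤ 6 ε L³ · H(θ)`, `H(θ) = Σ_b (1 - cos ∇_b θ)`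
(`fv_norm_Wk_le_energy`: entrywise `‖K‖ ≤ ε`, `|j_b j_{b'}| ≤ (j_b² + j_{b'}²)/2`, `sin² ≤ 2(1 - cos)`), the sup
bound `‖W_K‖ ≤ 9 ε L⁶`, `‖e^{W} - 1‖ ≤ ‖W‖ e^{‖W‖}` and the Laplace principle `⟨H⟩_{J,L} → 0`
(`rotatorEnergyLaplace`) give `‖Z_K - Z_0‖ ≤ η Z_0` and `‖num_K - num_0‖ ≤ η L⁶ Z_0` uniformly over the
admissible class, for `J ≥ J₀(η, ε, L)`.  Together with `stub_smallVolumeStability` (small tori at every `J`)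
this pins the open content of the crux-sized stub `stub_complexStability` down to one thing: the uniformity
of `J₀` in `L`.
-/

noncomputable section

namespace Summit.HubbardSuperconductivity.HubbardSuperconductivity.Theorems.PerturbedXYOrder

open MeasureTheory Literature.Probability.LatticeModels
open Summit.HubbardSuperconductivity.HubbardSuperconductivity.Theses.NodalWardXY

variable {L : ℕ}

/-! ### The relative form bound and the perturbative estimate -/

/-- `sin² x ≤ 2 (1 - cos x)`. -/
theorem fv_sin_sq_le (x : ℝ) : Real.sin x ^ 2 ≤ 2 * (1 - Real.cos x) := by
  nlinarith [Real.sin_sq_add_cos_sq x, Real.cos_le_one x, Real.neg_one_le_cos x]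

/-- `Σ_i Σ_j (f i + f j) = 2 · card · Σ_i f i` on a finite type. -/
theorem fv_sum_sum_add {ι : Type*} [Fintype ι] (f : ι → ℝ) :
    ∑ i, ∑ j, (f i + f j) = 2 * (Fintype.card ι : ℝ) * ∑ i, f i := by
  simp only [Finset.sum_add_distrib, Finset.sum_const, Finset.card_univ, nsmul_eq_mul, ← Finset.mul_sum]
  ring

/-- **Relative form bound** (volume-dependent constant): for `K` admissible at radius `ε`,
`‖W_K(θ)‖ ≤ 6 ε L³ · Σ_b (1 - cos ∇_b θ)` (entrywise `‖K‖ ≤ ε`, `|j_b||j_{b'}| ≤ (j_b² + j_{b'}²)/2`,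
`j² = sin² ≤ 2(1 - cos)`). -/
theorem fv_norm_Wk_le_energy [NeZero L] {ε : ℝ} {K : Bond L → Bond L → ℂ} (hK : Admissible L ε K)
    (θ : TorusSite 3 L → ℝ) :
    ‖Wk K θ‖ ≤ 6 * ε * (L : ℝ) ^ 3 * ∑ b : Bond L, (1 - Real.cos (θ (b.1 + Pi.single b.2 1) - θ b.1)) := by
  have hKε : ∀ b b', ‖K b b'‖ ≤ ε := fun b b' => by
    have h := hK b b'
    have h1 : (1:ℝ) ≤ (1 + ((torusGraph 3 L).dist b.1 b'.1 : ℝ)) ^ 4 :=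
      one_le_pow₀ (le_add_of_nonneg_right (Nat.cast_nonneg _))
    have hε : 0 ≤ ε := by
      by_contra hneg
      have : ε / (1 + ((torusGraph 3 L).dist b.1 b'.1 : ℝ)) ^ 4 < 0 :=
        div_neg_of_neg_of_pos (not_le.1 hneg) (by positivity)
      linarith [norm_nonneg (K b b')]
    exact h.trans (div_le_self hε h1)
  set s : Bond L → ℝ := fun b => cur b θ with hs
  have hterm : ∀ b b', ‖K b b' * (cur b θ : ℂ) * (cur b' θ : ℂ)‖ ≤ ε * ((s b) ^ 2 + (s b') ^ 2) / 2 := by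
    intro b b'
    rw [norm_mul, norm_mul, Complex.norm_real, Complex.norm_real, Real.norm_eq_abs, Real.norm_eq_abs]
    have h2 : |cur b θ| * |cur b' θ| ≤ ((s b) ^ 2 + (s b') ^ 2) / 2 := by
      have := two_mul_le_add_sq (|cur b θ|) (|cur b' θ|)
      simp only [sq_abs, hs] at this ⊢
      linarith
    have hε0 : 0 ≤ ε := le_trans (norm_nonneg _) (hKε b b')
    calc ‖K b b'‖ * |cur b θ| * |cur b' θ| = ‖K b b'‖ * (|cur b θ| * |cur b' θ|) := by ring
      _ ≤ ε * (((s b) ^ 2 + (s b') ^ 2) / 2) :=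
          mul_le_mul (hKε b b') h2 (by positivity) hε0
      _ = ε * ((s b) ^ 2 + (s b') ^ 2) / 2 := by ring
  have hsq : ∀ b : Bond L, (s b) ^ 2 ≤ 2 * (1 - Real.cos (θ (b.1 + Pi.single b.2 1) - θ b.1)) := fun b =>
    fv_sin_sq_le _
  unfold Wk
  calc ‖∑ b : Bond L, ∑ b' : Bond L, K b b' * (cur b θ : ℂ) * (cur b' θ : ℂ)‖
      ≤ ∑ b : Bond L, ∑ b' : Bond L, ‖K b b' * (cur b θ : ℂ) * (cur b' θ : ℂ)‖ :=
        (norm_sum_le _ _).trans (Finset.sum_le_sum fun b _ => norm_sum_le _ _)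
    _ ≤ ∑ b : Bond L, ∑ b' : Bond L, ε * ((s b) ^ 2 + (s b') ^ 2) / 2 := by
        gcongr with b _ b' _; exact hterm b b'
    _ = ε * (Fintype.card (Bond L) : ℝ) * ∑ b : Bond L, (s b) ^ 2 := by
        have h := fv_sum_sum_add (fun b : Bond L => (s b) ^ 2)
        have e : ∀ b b' : Bond L, ε * ((s b) ^ 2 + (s b') ^ 2) / 2 = (ε / 2) * ((s b) ^ 2 + (s b') ^ 2) :=
          fun b b' => by ring
        simp_rw [e, ← Finset.mul_sum, h]
        ring
    _ ≤ ε * (Fintype.card (Bond L) : ℝ) * ∑ b : Bond L, 2 * (1 - Real.cos (θ (b.1 + Pi.single b.2 1) - θ b.1)) := by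
        have hε0 : 0 ≤ ε * (Fintype.card (Bond L) : ℝ) := by
          have b0 : Bond L := ((fun _ => 0), 0)
          exact mul_nonneg (le_trans (norm_nonneg _) (hKε b0 b0)) (Nat.cast_nonneg _)
        exact mul_le_mul_of_nonneg_left (Finset.sum_le_sum fun b _ => hsq b) hε0
    _ = 6 * ε * (L : ℝ) ^ 3 * ∑ b : Bond L, (1 - Real.cos (θ (b.1 + Pi.single b.2 1) - θ b.1)) := by
        rw [← Finset.mul_sum]
        simp only [Fintype.card_prod, Fintype.card_fun, Fintype.card_fin, ZMod.card]
        push_cast; ring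

/-! ### The perturbative estimate at fixed volume -/

/-- **Master estimate at fixed volume.** For every radius `ε`, torus `L` and `η > 0` there is `J₀` such that for
all `J ≥ J₀` and all kernels `K` admissible at radius `ε`:
`‖Z_K - Z_0‖ ≤ η Z_0` and `‖num_K - num_0‖ ≤ η L⁶ Z_0`, where `Z_0 = ∫_cube e^{J Σ cos} > 0`
(`‖e^{W} - 1‖ ≤ ‖W‖ e^{‖W‖} ≤ 6εL³ H e^{9εL⁶}` and the Laplace principle `⟨H⟩_J → 0`). -/
theorem fv_master [NeZero L] (ε : ℝ) {η : ℝ} (hη : 0 < η) :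
    ∃ J₀ : ℝ, ∀ J : ℝ, J₀ ≤ J → ∀ K : Bond L → Bond L → ℂ, Admissible L ε K →
      ‖Zk J K - Zk J (0 : Bond L → Bond L → ℂ)‖ ≤
          η * ∫ θ in cube L, Real.exp (J * ∑ b : Bond L, Real.cos (θ (b.1 + Pi.single b.2 1) - θ b.1)) ∧
      ‖num J K - num J (0 : Bond L → Bond L → ℂ)‖ ≤ η * (L : ℝ) ^ 6 *
        ∫ θ in cube L, Real.exp (J * ∑ b : Bond L, Real.cos (θ (b.1 + Pi.single b.2 1) - θ b.1)) := by
  haveI := ent_isFiniteMeasure_restrict_cube (L := L)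
  -- constants: `C = 6 |ε| L³` (form bound), `M = 9 |ε| L⁶` (sup bound)
  set C : ℝ := 6 * |ε| * (L : ℝ) ^ 3 with hCdef
  set M : ℝ := 9 * |ε| * (L : ℝ) ^ 6 with hMdef
  have hC : 0 ≤ C := by positivity
  set η' : ℝ := η / (C * Real.exp M + 1) with hη'def
  have hden : 0 < C * Real.exp M + 1 := by positivity
  have hη' : 0 < η' := by positivity
  have hη'le : C * Real.exp M * η' ≤ η := by
    rw [hη'def, mul_div_assoc', div_le_iff₀ hden]
    nlinarith [Real.exp_pos M, hη.le]
  obtain ⟨J₀, hJ₀⟩ := rotatorEnergyLaplace L η' hη'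
  refine ⟨J₀, fun J hJ K hK => ?_⟩
  -- notation
  set r : (TorusSite 3 L → ℝ) → ℝ := fun θ =>
    Real.exp (J * ∑ b : Bond L, Real.cos (θ (b.1 + Pi.single b.2 1) - θ b.1)) with hrdef
  set Hf : (TorusSite 3 L → ℝ) → ℝ := fun θ =>
    ∑ b : Bond L, (1 - Real.cos (θ (b.1 + Pi.single b.2 1) - θ b.1)) with hHdef
  have hLap : ∫ θ in cube L, Hf θ * r θ ≤ η' * ∫ θ in cube L, r θ := hJ₀ J hJ
  have hε : 0 ≤ ε := by
    have b0 : Bond L := ((fun _ => 0), 0)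
    have h := hK b0 b0
    by_contra hneg
    have : ε / (1 + ((torusGraph 3 L).dist b0.1 b0.1 : ℝ)) ^ 4 < 0 :=
      div_neg_of_neg_of_pos (not_le.1 hneg) (by positivity)
    linarith [norm_nonneg (K b0 b0)]
  have habs : |ε| = ε := abs_of_nonneg hε
  -- pointwise bound on `‖e^{W_K} - 1‖`
  have hWM : ∀ θ, ‖Wk K θ‖ ≤ M := fun θ => by
    calc ‖Wk K θ‖ ≤ ∑ b : Bond L, ∑ b' : Bond L, ‖K b b'‖ := ent_norm_Wk_le K θ
      _ ≤ ∑ b : Bond L, ∑ b' : Bond L, ε := by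
          gcongr with b _ b' _
          have h := hK b b'
          have h1 : (1:ℝ) ≤ (1 + ((torusGraph 3 L).dist b.1 b'.1 : ℝ)) ^ 4 :=
            one_le_pow₀ (le_add_of_nonneg_right (Nat.cast_nonneg _))
          exact h.trans (div_le_self hε h1)
      _ = M := by
          rw [hMdef, habs]
          simp only [Finset.sum_const, Finset.card_univ, nsmul_eq_mul, Fintype.card_prod, Fintype.card_fun,
            Fintype.card_fin, ZMod.card]
          push_cast; ring
  have hD : ∀ θ, ‖Complex.exp (Wk K θ) - 1‖ ≤ C * Real.exp M * Hf θ := fun θ => by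
    have h1 : ‖Complex.exp (Wk K θ) - 1‖ ≤ ‖Wk K θ‖ * Real.exp ‖Wk K θ‖ := by
      simpa using Complex.norm_exp_sub_sum_le_norm_mul_exp (Wk K θ) 1
    have h2 : ‖Wk K θ‖ ≤ C * Hf θ := by rw [hCdef, habs]; exact fv_norm_Wk_le_energy hK θ
    have h3 : Real.exp ‖Wk K θ‖ ≤ Real.exp M := Real.exp_le_exp.2 (hWM θ)
    calc ‖Complex.exp (Wk K θ) - 1‖ ≤ ‖Wk K θ‖ * Real.exp ‖Wk K θ‖ := h1
      _ ≤ (C * Hf θ) * Real.exp M := mul_le_mul h2 h3 (Real.exp_pos _).le (mul_nonneg hC (fv_energy_nonneg θ))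
      _ = C * Real.exp M * Hf θ := by ring
  -- the generic estimate: for `‖g‖ ≤ 1` continuous, `‖∫ g · w_J (e^{W_K} - 1)‖ ≤ η Z_0`
  have hr_cont : Continuous r := continuous_xyWeight J
  have hHf_cont : Continuous Hf := fv_continuous_energy
  have hri : Integrable r (volume.restrict (cube L)) := hr_cont.continuousOn.integrableOn_compact ent_isCompact_cube
  have key : ∀ g : (TorusSite 3 L → ℝ) → ℂ, Continuous g → (∀ θ, ‖g θ‖ ≤ 1) →
      ‖∫ θ in cube L, g θ * (wJ J θ * (Complex.exp (Wk K θ) - 1))‖ ≤ η * ∫ θ in cube L, r θ := by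
    intro g hg hg1
    have hbound : ∀ θ, ‖g θ * (wJ J θ * (Complex.exp (Wk K θ) - 1))‖ ≤ C * Real.exp M * (Hf θ * r θ) := by
      intro θ
      rw [norm_mul, norm_mul]
      have hw : ‖wJ J θ‖ = r θ := by
        unfold wJ; rw [Complex.norm_real, Real.norm_eq_abs, Real.abs_exp]
      rw [hw]
      calc ‖g θ‖ * (r θ * ‖Complex.exp (Wk K θ) - 1‖) ≤ 1 * (r θ * (C * Real.exp M * Hf θ)) := by
            gcongr
            · exact hg1 θ
            · exact hD θ
        _ = C * Real.exp M * (Hf θ * r θ) := by ring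
    have hint2 : Integrable (fun θ => C * Real.exp M * (Hf θ * r θ)) (volume.restrict (cube L)) :=
      ((hHf_cont.mul hr_cont).continuousOn.integrableOn_compact ent_isCompact_cube).const_mul _
    calc ‖∫ θ in cube L, g θ * (wJ J θ * (Complex.exp (Wk K θ) - 1))‖
        ≤ ∫ θ in cube L, ‖g θ * (wJ J θ * (Complex.exp (Wk K θ) - 1))‖ := norm_integral_le_integral_norm _
      _ ≤ ∫ θ in cube L, C * Real.exp M * (Hf θ * r θ) :=
          integral_mono_of_nonneg (ae_of_all _ fun θ => norm_nonneg _) hint2 (ae_of_all _ hbound)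
      _ = C * Real.exp M * ∫ θ in cube L, Hf θ * r θ := integral_const_mul _ _
      _ ≤ C * Real.exp M * (η' * ∫ θ in cube L, r θ) := mul_le_mul_of_nonneg_left hLap (by positivity)
      _ = (C * Real.exp M * η') * ∫ θ in cube L, r θ := by ring
      _ ≤ η * ∫ θ in cube L, r θ :=
          mul_le_mul_of_nonneg_right hη'le (integral_nonneg fun θ => (Real.exp_pos _).le)
  -- integrability of the perturbed integrands
  have hI : ∀ (g : (TorusSite 3 L → ℝ) → ℂ), Continuous g → ∀ K' : Bond L → Bond L → ℂ,
      Integrable (fun θ => g θ * (wJ J θ * Complex.exp (Wk K' θ))) (volume.restrict (cube L)) :=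
    fun g hg K' => (hg.mul ((ent_continuous_wJ J).mul (Complex.continuous_exp.comp
      (ent_continuous_Wk K')))).continuousOn.integrableOn_compact ent_isCompact_cube
  have hW0 : ∀ θ : TorusSite 3 L → ℝ, Wk (0 : Bond L → Bond L → ℂ) θ = 0 := fun θ => by simp [Wk]
  constructor
  · -- partition function: `g = 1`
    have h := key (fun _ => 1) continuous_const (fun θ => by simp)
    have e : Zk J K - Zk J (0 : Bond L → Bond L → ℂ) = ∫ θ in cube L, (1 : ℂ) * (wJ J θ * (Complex.exp (Wk K θ) - 1)) := by
      unfold Zk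
      rw [← integral_sub]
      · refine integral_congr_ae (ae_of_all _ fun θ => ?_)
        simp only [hW0, Complex.exp_zero, one_mul]
        ring
      · simpa using hI (fun _ => 1) continuous_const K
      · simpa using hI (fun _ => 1) continuous_const 0
    rw [e]; exact h
  · -- numerator: `g = cos(θ_x - θ_y)`, summed over `L⁶` pairs
    have hcos : ∀ x y : TorusSite 3 L, Continuous fun θ : TorusSite 3 L → ℝ => ((Real.cos (θ x - θ y) : ℝ) : ℂ) :=
      fun x y => by fun_prop
    have hterm : ∀ x y : TorusSite 3 L,
        ‖(∫ θ in cube L, (Real.cos (θ x - θ y) : ℂ) * (wJ J θ * Complex.exp (Wk K θ))) -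
            ∫ θ in cube L, (Real.cos (θ x - θ y) : ℂ) * (wJ J θ * Complex.exp (Wk (0 : Bond L → Bond L → ℂ) θ))‖ ≤
          η * ∫ θ in cube L, r θ := by
      intro x y
      have h := key _ (hcos x y) (fun θ => by
        rw [Complex.norm_real, Real.norm_eq_abs]; exact Real.abs_cos_le_one _)
      rw [← integral_sub (hI _ (hcos x y) K) (hI _ (hcos x y) 0)]
      have e : (fun θ : TorusSite 3 L → ℝ => (Real.cos (θ x - θ y) : ℂ) * (wJ J θ * Complex.exp (Wk K θ)) -
          (Real.cos (θ x - θ y) : ℂ) * (wJ J θ * Complex.exp (Wk (0 : Bond L → Bond L → ℂ) θ))) =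
          fun θ => (Real.cos (θ x - θ y) : ℂ) * (wJ J θ * (Complex.exp (Wk K θ) - 1)) := by
        funext θ
        simp only [hW0, Complex.exp_zero]
        ring
      rw [e]; exact h
    unfold num
    rw [← Finset.sum_sub_distrib]
    calc ‖∑ x : TorusSite 3 L, ((∑ y : TorusSite 3 L,
            ∫ θ in cube L, (Real.cos (θ x - θ y) : ℂ) * (wJ J θ * Complex.exp (Wk K θ))) -
            ∑ y : TorusSite 3 L, ∫ θ in cube L, (Real.cos (θ x - θ y) : ℂ) *
              (wJ J θ * Complex.exp (Wk (0 : Bond L → Bond L → ℂ) θ)))‖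
        ≤ ∑ x : TorusSite 3 L, ‖(∑ y : TorusSite 3 L,
            ∫ θ in cube L, (Real.cos (θ x - θ y) : ℂ) * (wJ J θ * Complex.exp (Wk K θ))) -
            ∑ y : TorusSite 3 L, ∫ θ in cube L, (Real.cos (θ x - θ y) : ℂ) *
              (wJ J θ * Complex.exp (Wk (0 : Bond L → Bond L → ℂ) θ))‖ := norm_sum_le _ _
      _ ≤ ∑ x : TorusSite 3 L, ∑ y : TorusSite 3 L,
            ‖(∫ θ in cube L, (Real.cos (θ x - θ y) : ℂ) * (wJ J θ * Complex.exp (Wk K θ))) -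
              ∫ θ in cube L, (Real.cos (θ x - θ y) : ℂ) *
                (wJ J θ * Complex.exp (Wk (0 : Bond L → Bond L → ℂ) θ))‖ := by
          refine Finset.sum_le_sum fun x _ => ?_
          rw [← Finset.sum_sub_distrib]
          exact norm_sum_le _ _
      _ ≤ ∑ _x : TorusSite 3 L, ∑ _y : TorusSite 3 L, η * ∫ θ in cube L, r θ := by
          gcongr with x _ y _; exact hterm x y
      _ = η * (L : ℝ) ^ 6 * ∫ θ in cube L, r θ := by
          simp only [Finset.sum_const, Finset.card_univ, nsmul_eq_mul, Fintype.card_fun, Fintype.card_fin, ZMod.card]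
          push_cast; ring

/-- **Complex stability, volume by volume.** For every radius `ε` and every torus `(ℤ/Lℤ)³` there is
`J₀ = J₀(ε, L)` such that for all `J ≥ J₀` every kernel admissible at radius `ε` has `Z_K ≠ 0` and
`‖cratio‖ ≤ 2` (`fv_master` with `η = 1/4`: `‖Z_K‖ ≥ ¾ Z_0`, `‖num_K‖ ≤ (1 + ¼) L⁶ Z_0`).  The registered open
stub `stub_complexStability` is exactly the assertion that `J₀` can be taken independent of `L`. -/
theorem stub_fixedVolumeStability : ∀ (ε : ℝ) (L : ℕ) [NeZero L], ∃ J₀ : ℝ, ∀ J : ℝ, J₀ ≤ J →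
    ∀ K : Bond L → Bond L → ℂ, Admissible L ε K → Zk J K ≠ 0 ∧ ‖cratio L J K‖ ≤ 2 := by
  intro ε L _
  obtain ⟨J₀, hJ₀⟩ := fv_master (L := L) ε (η := 1 / 4) (by norm_num)
  refine ⟨J₀, fun J hJ K hK => ?_⟩
  obtain ⟨hZ, hN⟩ := hJ₀ J hJ K hK
  set Z0 : ℝ := ∫ θ in cube L, Real.exp (J * ∑ b : Bond L, Real.cos (θ (b.1 + Pi.single b.2 1) - θ b.1))
    with hZ0def
  have hZ0pos : 0 < Z0 := integral_xyWeight_pos (L := L) J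
  have hcube : (Set.pi Set.univ fun _ : TorusSite 3 L => Set.Icc (0 : ℝ) (2 * Real.pi)) = cube L := rfl
  have hZk0 : Zk J (0 : Bond L → Bond L → ℂ) = (Z0 : ℂ) := by rw [even_Zk_zero_eq]; rfl
  have hnum0 : ‖num J (0 : Bond L → Bond L → ℂ)‖ ≤ (L : ℝ) ^ 6 * Z0 := by
    rw [even_num_zero_eq, Complex.norm_real, Real.norm_eq_abs]
    exact abs_num_real_le J
  have hZlow : 3 / 4 * Z0 ≤ ‖Zk J K‖ := by
    have h1 : ‖Zk J (0 : Bond L → Bond L → ℂ)‖ = Z0 := by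
      rw [hZk0, Complex.norm_real, Real.norm_eq_abs, abs_of_pos hZ0pos]
    have h2 : ‖Zk J (0 : Bond L → Bond L → ℂ)‖ - ‖Zk J K - Zk J (0 : Bond L → Bond L → ℂ)‖ ≤ ‖Zk J K‖ := by
      have := norm_sub_norm_le (Zk J (0 : Bond L → Bond L → ℂ)) (Zk J K)
      rw [norm_sub_rev] at this
      linarith
    linarith
  have hNup : ‖num J K‖ ≤ 5 / 4 * ((L : ℝ) ^ 6 * Z0) := by
    have h2 : ‖num J K‖ ≤ ‖num J (0 : Bond L → Bond L → ℂ)‖ + ‖num J K - num J (0 : Bond L → Bond L → ℂ)‖ := by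
      have := norm_add_le (num J (0 : Bond L → Bond L → ℂ)) (num J K - num J (0 : Bond L → Bond L → ℂ))
      rwa [add_sub_cancel] at this
    linarith
  have hL : (0:ℝ) < (L : ℝ) ^ 6 := by
    have := NeZero.pos L; positivity
  have hZpos : 0 < ‖Zk J K‖ := by linarith [mul_pos (by norm_num : (0:ℝ) < 3 / 4) hZ0pos]
  refine ⟨norm_pos_iff.1 hZpos, ?_⟩
  unfold cratio
  rw [norm_div, norm_div]
  have hL' : ‖((L : ℂ)) ^ 6‖ = (L : ℝ) ^ 6 := by simp
  rw [hL', div_div, div_le_iff₀ (by positivity)]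
  nlinarith

end Summit.HubbardSuperconductivity.HubbardSuperconductivity.Theorems.PerturbedXYOrder

end
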